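import Mathlib
import HarnessLib
import Literature.Analysis.FluidPDE.Tao2016AveragedNS.BoundedEternalSolutions
import Summits.NavierStokesRegularity.NavierStokesRegularity.Theorems.TaoLadderRungTwoBreakNoSurvivingDSSOneSmallRatioNormalForm
import Summits.NavierStokesRegularity.NavierStokesRegularity.Theorems.TaoLadderRungTwoBreakNoSurvivingDSSOneWideFront

/-!
# Crux `TaoLadderRungTwoBreak.NoSurvivingDSSOne` (stmt-NavierStokesRegularity-20205): the WIDE-FRONT SLICE — a surviving admissible
# DSS wave with rescaled instantaneous mass `≤ M` and action `≤ A` forces `ε₀ ≥ εs(C_A, M, A, q)`, with `εs` POLYNOMIAL in the action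

MODEL lattice ODEs only (Tao 2016 §4, §6.4; cell vocabulary `IsDSSWave`, `Surviving`, `sMass`, `fluxConst`); nothing here is a statement
about the Navier–Stokes equations; no stub, crux or summit is closed (`--supports stmt-NavierStokesRegularity-20205`).

`dssWave_wideFront_inequality`: a NON-TRIVIAL admissible DSS wave `Φ` of a cancelling table at scale ratio `1+ε₀` that is (S₁)-surviving
(`Surviving 1 ε₀ T`), with RESCALED instantaneous mass `ε₀·Σ_r‖Φ_r(x)‖ ≤ M` for all `x` and action `∫Σ_r‖Φ_r‖ ≤ A`, under the leak budget
`8ε₀C_A·A ≤ 1`, satisfies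
`δ₀² ≤ 32·ε₀·C_A·A·exp((2C_A(M+δ₀) + 2ε₀C_A·M)·5/2)·max(δ₀², q·M²)`, `δ₀ = 1/(20(C_A+1))`, `q` the number of profiles —
i.e. `ε₀ ≥ δ₀²e^{−5C_A(M+δ₀)−5ε₀C_AM}/(32C_A·A·max(δ₀², qM²))`.  Contrapositively: **the slice of K1(1) `NoSurvivingDSSOne` consisting of the
DSS waves with rescaled instantaneous mass `≤ M`, action `≤ A` and `≤ q` profiles holds with an EXPLICIT threshold `εs(M, A, q)` that is
polynomial in `A` and `q` and exponential only in `M`** (the tree's bounded-action slice `…ActionFloor.noSurvivingDSS_rung_boundedAction` has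
`εs ≈ e^{−4C_A·A}`; the natural small-ratio scaling has `M = O(1)`, `A` large for WIDE fronts — the continuum-limit regime).
Chain: `smallRatio_normalForm` (exact rescaling to the `(ε₀, Λ, Λ⁻¹, T/ε₀)`-system, lag `< 5/2`), the survival window
(`Λe^{−2T} − Λ⁻¹ ≤ ε₀`, `Λ⁻¹ ≤ Λe^{−2T}`), and `IsSWave.asymmetry_mul_action_ge` (`…WideFront`: Theorem A′ with leak + wake–throughput).
HONEST LABEL: what K1(1) still adds is `M → ∞` (tall rescaled fronts, `sup sMass Φ ≫ 1/ε₀`) and the leak regime `A ≳ 1/(8C_Aε₀)`; ⟨20205⟩,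
(ρ0) and every NS statement remain OPEN.
-/

noncomputable section

-- the summit and its single sub-problem share the name (CONVENTIONS §1)
set_option linter.dupNamespace false

namespace Summit.NavierStokesRegularity.NavierStokesRegularity.Theorems.NoSurvivingDSSOne.LeakyFront

open Set Filter Topology MeasureTheory
open scoped RealInnerProductSpace
open Literature.Analysis.FluidPDE Literature.Analysis.FluidPDE.TaoCascade
open Summit.NavierStokesRegularity.NavierStokesRegularity.Theorems.NoSurvivingDSSOne.NormalForm

variable {m : ℕ} {ρ : Type*} [Fintype ρ]

/-- **THE WIDE-FRONT INEQUALITY FOR SURVIVING DSS WAVES** (see the module docstring).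
[cite: Tao2016AveragedNS, §4 (4.2)–(4.3), Lemma 4.1 (4.8)–(4.10), §6.4; cell vocabulary; tree: `smallRatio_normalForm`, `IsSWave.asymmetry_mul_action_ge`] -/
theorem dssWave_wideFront_inequality {ε₀ : ℝ} (hε : 0 < ε₀) {α : Fin m → Fin m → Fin m → ℤ × ℤ × ℤ → ℝ}
    (hc : IsCancellingCoeff α) {π : Equiv.Perm ρ} {T : ℝ} {Φ : ρ → ℝ → Em m} (hΦ : IsDSSWave ε₀ α π T Φ)
    (hS : Surviving 1 ε₀ T) {r₀ : ρ} {x₀ : ℝ} (hne : Φ r₀ x₀ ≠ 0) {Mr A₀ : ℝ}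
    (hMr : ∀ x, ε₀ * sMass Φ x ≤ Mr) (hA₀ : ∫ x, sMass Φ x ≤ A₀) (hleak : 8 * ε₀ * fluxConst α * A₀ ≤ 1) :
    (1 / (20 * (fluxConst α + 1))) ^ 2 ≤ 32 * ε₀ * fluxConst α * A₀
      * Real.exp ((2 * fluxConst α * (Mr + 1 / (20 * (fluxConst α + 1))) + 2 * ε₀ * fluxConst α * Mr) * (5 / 2))
      * max ((1 / (20 * (fluxConst α + 1))) ^ 2) ((Fintype.card ρ : ℝ) * Mr ^ 2) := by
  have hST := table_sTable α hc
  set CA : ℝ := fluxConst α with hCAdef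
  have hCA : 0 ≤ CA := fluxConst_nonneg α
  set δ₀ : ℝ := 1 / (20 * (CA + 1)) with hδ₀def
  have hδ₀ : 0 < δ₀ := by rw [hδ₀def]; positivity
  clear_value δ₀ CA
  have hΛ : 0 < bigLam ε₀ := bigLam_pos (by linarith)
  have hΛ1 : 1 ≤ bigLam ε₀ := one_le_bigLam hε.le
  have hb : 0 < 1 + ε₀ := by linarith
  have hT := hΦ.delay_pos
  have hE := Real.exp_pos (2 * T)
  have hL5 : bigLam ε₀ ^ 2 = (1 + ε₀) ^ 5 := bigLam_sq hε.le
  -- the survival window in terms of `E = e^{2T}`: `(1+ε₀)^5 ≤ (1+ε₀)·E` and `E ≤ (1+ε₀)^5`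
  have hE2 : Real.exp (2 * T) ≤ (1 + ε₀) ^ 5 := by
    have h := hS.2; unfold dssMu at h
    exact ((div_lt_one (by positivity)).1 h).le
  have hE1 : (1 + ε₀) ^ 5 ≤ (1 + ε₀) * Real.exp (2 * T) := by
    have h := hS.1; unfold dssMu at h
    rw [Real.rpow_neg_one, le_div_iff₀ (by positivity)] at h
    have e : (1 + ε₀)⁻¹ * (1 + ε₀) ^ 5 * (1 + ε₀) = (1 + ε₀) ^ 5 := by field_simp
    have h2 := mul_le_mul_of_nonneg_right h hb.le
    rw [e] at h2
    linarith
  -- the rescaled parameters: `c₂ = Λ⁻¹ ≤ γ₁ = Λe^{−2ε₀τ}` and `γ₁ − c₂ ≤ ε₀`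
  have hτT : 2 * ε₀ * (T / ε₀) = 2 * T := by field_simp
  have hγ1 : bigLam ε₀ * Real.exp (-(2 * ε₀ * (T / ε₀))) = bigLam ε₀ * (Real.exp (2 * T))⁻¹ := by
    rw [hτT, Real.exp_neg]
  have hcmp : (bigLam ε₀)⁻¹ ≤ bigLam ε₀ * Real.exp (-(2 * ε₀ * (T / ε₀))) := by
    rw [hγ1, inv_le_iff_one_le_mul₀ hΛ,
      show bigLam ε₀ * (Real.exp (2 * T))⁻¹ * bigLam ε₀ = bigLam ε₀ ^ 2 / Real.exp (2 * T) by ring,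
      le_div_iff₀ hE, one_mul, hL5]
    exact hE2
  have hγle : bigLam ε₀ * Real.exp (-(2 * ε₀ * (T / ε₀))) - (bigLam ε₀)⁻¹ ≤ ε₀ := by
    rw [hγ1]
    have e : bigLam ε₀ * (Real.exp (2 * T))⁻¹ - (bigLam ε₀)⁻¹
        = (bigLam ε₀ ^ 2 - Real.exp (2 * T)) / (bigLam ε₀ * Real.exp (2 * T)) := by
      field_simp
    rw [e, div_le_iff₀ (by positivity), hL5]
    nlinarith [mul_nonneg hε.le hE.le, hΛ1]
  have hγ0 : 0 ≤ bigLam ε₀ * Real.exp (-(2 * ε₀ * (T / ε₀))) - (bigLam ε₀)⁻¹ := by linarith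
  -- the normal form
  obtain ⟨B, hB⟩ := hΦ.uniformBound
  obtain ⟨hwave, ⟨_, hτ⟩, hG, hint, ⟨ξ₀, P, hbdd⟩, hBΨ, _⟩ := smallRatio_normalForm hε hc hΦ hS hB hne
  have hτpos : 0 < T / ε₀ := div_pos hT hε
  -- the hypotheses of the wide-front inequality for `Ψ`
  have hMΨ : ∀ ξ, sMass (fun r ξ => ε₀ • Φ r (ε₀ * ξ)) ξ ≤ Mr := fun ξ => by
    rw [sMass_rescale hε.le]; exact hMr _
  have hAΨ : ∫ ξ, sMass (fun r ξ => ε₀ • Φ r (ε₀ * ξ)) ξ ≤ A₀ := by rw [hint]; exact hA₀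
  have hneΨ : ∃ r ξ, (fun r ξ => ε₀ • Φ r (ε₀ * ξ)) r ξ ≠ 0 := by
    refine ⟨r₀, x₀ / ε₀, ?_⟩
    have : ε₀ * (x₀ / ε₀) = x₀ := by field_simp
    simp only [this]
    exact smul_ne_zero hε.ne' hne
  have hbddΨ : ∀ ξ, ξ₀ ≤ ξ → Real.exp (2 * ε₀ * ξ) * sEnergy (fun r ξ => ε₀ • Φ r (ε₀ * ξ)) ξ ≤ P := fun ξ hξ => hbdd ξ hξ
  have hCTδ : 8 * ((bigLam ε₀)⁻¹ * CA) * (T / ε₀) * δ₀ ≤ 1 := by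
    have h1 : (bigLam ε₀)⁻¹ * CA ≤ CA := mul_le_of_le_one_left hCA (inv_le_one_of_one_le₀ hΛ1)
    have h2 : 0 ≤ (bigLam ε₀)⁻¹ * CA := by positivity
    have h3 : 8 * ((bigLam ε₀)⁻¹ * CA) * (T / ε₀) * δ₀ ≤ 8 * CA * (5 / 2) * δ₀ := by
      have := mul_le_mul_of_nonneg_right (mul_le_mul h1 hτ.le hτpos.le hCA) hδ₀.le
      linarith
    have h4 : 8 * CA * (5 / 2) * δ₀ = CA / (CA + 1) := by rw [hδ₀def]; field_simp; ring
    rw [h4] at h3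
    exact h3.trans ((div_le_one (by positivity)).2 (by linarith))
  have hA0 : 0 ≤ A₀ := (integral_nonneg (sMass_nonneg Φ)).trans hA₀
  have hρA : 4 * (2 * (bigLam ε₀ * Real.exp (-(2 * ε₀ * (T / ε₀))) - (bigLam ε₀)⁻¹) * CA) * A₀ ≤ 1 := by
    have := mul_le_mul_of_nonneg_right (mul_le_mul_of_nonneg_right hγle hCA) hA0
    linarith
  have hmain := IsSWave.asymmetry_mul_action_ge hST hτpos hε (inv_pos.2 hΛ) hcmp hwave hG hBΨ hMΨ hAΨ hbddΨ hneΨ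
    hδ₀ hCTδ hρA
  -- replace `γ` by `ε₀` and the exponent by its survival-window bound
  set γ : ℝ := bigLam ε₀ * Real.exp (-(2 * ε₀ * (T / ε₀))) - (bigLam ε₀)⁻¹ with hγdef
  set c2 : ℝ := (bigLam ε₀)⁻¹ * CA with hc2def
  clear_value γ c2
  have hMr0 : 0 ≤ Mr := le_trans (mul_nonneg hε.le (sMass_nonneg Φ 0)) (hMr 0)
  have hmax0 : 0 ≤ max (δ₀ ^ 2) ((Fintype.card ρ : ℝ) * Mr ^ 2) := le_trans (sq_nonneg _) (le_max_left _ _)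
  have hc2le : c2 ≤ CA := by rw [hc2def]; exact mul_le_of_le_one_left hCA (inv_le_one_of_one_le₀ hΛ1)
  have hc20 : 0 ≤ c2 := by rw [hc2def]; positivity
  have hk : (2 * c2 * (Mr + δ₀) + 2 * γ * CA * Mr) * (T / ε₀) ≤ (2 * CA * (Mr + δ₀) + 2 * ε₀ * CA * Mr) * (5 / 2) := by
    have h2 : 2 * c2 * (Mr + δ₀) ≤ 2 * CA * (Mr + δ₀) := by
      have := mul_le_mul_of_nonneg_right hc2le (by linarith : 0 ≤ Mr + δ₀)
      linarith
    have h3 : 2 * γ * CA * Mr ≤ 2 * ε₀ * CA * Mr := by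
      have := mul_le_mul_of_nonneg_right (mul_le_mul_of_nonneg_right hγle hCA) hMr0
      linarith
    have h4a : 0 ≤ c2 * (Mr + δ₀) := mul_nonneg hc20 (by linarith)
    have h4b : 0 ≤ γ * CA * Mr := mul_nonneg (mul_nonneg hγ0 hCA) hMr0
    have h5a : 0 ≤ CA * (Mr + δ₀) := mul_nonneg hCA (by linarith)
    have h5b : 0 ≤ ε₀ * CA * Mr := mul_nonneg (mul_nonneg hε.le hCA) hMr0
    have h5 : 0 ≤ 2 * CA * (Mr + δ₀) + 2 * ε₀ * CA * Mr := by linarith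
    calc (2 * c2 * (Mr + δ₀) + 2 * γ * CA * Mr) * (T / ε₀)
        ≤ (2 * CA * (Mr + δ₀) + 2 * ε₀ * CA * Mr) * (T / ε₀) := mul_le_mul_of_nonneg_right (by linarith) hτpos.le
      _ ≤ (2 * CA * (Mr + δ₀) + 2 * ε₀ * CA * Mr) * (5 / 2) := mul_le_mul_of_nonneg_left hτ.le h5
  have hexp := Real.exp_le_exp.2 hk
  have hX : 32 * γ * CA * A₀ ≤ 32 * ε₀ * CA * A₀ := by
    have := mul_le_mul_of_nonneg_right (mul_le_mul_of_nonneg_right hγle hCA) hA0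
    linarith
  have hX1 : 0 ≤ 32 * ε₀ * CA * A₀ := mul_nonneg (mul_nonneg (mul_nonneg (by norm_num) hε.le) hCA) hA0
  have h1 := mul_le_mul hX hexp (Real.exp_pos _).le hX1
  exact hmain.trans (mul_le_mul_of_nonneg_right h1 hmax0)

/-- **THE WIDE-FRONT SLICE OF K1(1) IN THE CRUX'S BINDER SHAPE.**  For every spread `R`, every rescaled-mass budget `M ≥ 0`, action
budget `A ≥ 0` and period bound: for all `ε₀ ∈ (0, 1]` with `512·ε₀·A ≤ 1` and
`2048·ε₀·A·exp((128(M+1) + 128M)·5/2)·(1 + 1300²·q·M²) < 1` (`q` = number of profiles), every admissible DSS wave of a table of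
`InTableClass R` that is (S₁)-surviving, has rescaled instantaneous mass `ε₀·Σ_r‖Φ_r(x)‖ ≤ M` and action `∫Σ_r‖Φ_r‖ ≤ A`, is TRIVIAL.
(`NoSurvivingDSSOne`'s inner statement with two extra hypotheses and an explicit threshold polynomial in `A` and `q`.)
[cite: Tao2016AveragedNS, §4 Thm. 4.2 (statement shape), Lemma 4.1 (4.8)–(4.10), §6.4; this file] -/
theorem noSurvivingDSS_rung_wideFront (R M A : ℝ) {ε₀ : ℝ} (hε : 0 < ε₀) (hε1 : ε₀ ≤ 1)
    (hleak : 512 * ε₀ * A ≤ 1)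
    {α : Fin 4 → Fin 4 → Fin 4 → ℤ × ℤ × ℤ → ℝ} (hα : InTableClass R α)
    {π : Equiv.Perm ρ} {T : ℝ} {Φ : ρ → ℝ → Em 4} (hΦ : IsDSSWave ε₀ α π T Φ) (hS : Surviving 1 ε₀ T)
    (hMr : ∀ x, ε₀ * sMass Φ x ≤ M) (hA : ∫ x, sMass Φ x ≤ A)
    (hsmall : 2048 * ε₀ * A * Real.exp ((128 * (M + 1) + 128 * M) * (5 / 2))
      * (1 + 1300 ^ 2 * (Fintype.card ρ : ℝ) * M ^ 2) < 1) :
    ∀ r x, Φ r x = 0 := by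
  intro r x
  by_contra hne
  set CA : ℝ := fluxConst α with hCAdef
  have hCA : 0 ≤ CA := fluxConst_nonneg α
  have hCA64 : CA ≤ 64 := NoSurvivingEternalViscBddOne.SmallAction.fluxConst_le_64 hα
  have hA0 : 0 ≤ A := (integral_nonneg (sMass_nonneg Φ)).trans hA
  have hM0 : 0 ≤ M := le_trans (mul_nonneg hε.le (sMass_nonneg Φ 0)) (hMr 0)
  set q : ℝ := (Fintype.card ρ : ℝ) with hq
  have hq0 : 0 ≤ q := by rw [hq]; positivity
  have hleak' : 8 * ε₀ * fluxConst α * A ≤ 1 := by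
    have : 8 * ε₀ * fluxConst α * A ≤ 8 * ε₀ * 64 * A := by
      rw [← hCAdef]
      have := mul_le_mul_of_nonneg_left hCA64 (by positivity : 0 ≤ 8 * ε₀)
      exact mul_le_mul_of_nonneg_right this hA0
    linarith
  have h := dssWave_wideFront_inequality hε hα.2.1 hΦ hS hne hMr hA hleak'
  rw [← hCAdef] at h
  set δ₀ : ℝ := 1 / (20 * (CA + 1)) with hδ₀def
  have hδ₀ : 0 < δ₀ := by rw [hδ₀def]; positivity
  have hδ₀1 : δ₀ ≤ 1 := by
    rw [hδ₀def, div_le_one (by positivity)]; nlinarith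
  have hδinv : 1 ≤ 1300 ^ 2 * δ₀ ^ 2 := by
    have h1 : 20 * (CA + 1) ≤ 1300 := by linarith
    have h2 : (1 : ℝ) = (20 * (CA + 1)) ^ 2 * δ₀ ^ 2 := by rw [hδ₀def]; field_simp
    have h3 : (20 * (CA + 1)) ^ 2 ≤ 1300 ^ 2 := pow_le_pow_left₀ (by positivity) h1 2
    nlinarith [sq_nonneg δ₀]
  -- the exponent and the table constant at their class bounds
  have hk : (2 * CA * (M + δ₀) + 2 * ε₀ * CA * M) * (5 / 2) ≤ (128 * (M + 1) + 128 * M) * (5 / 2) := by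
    have h1 : 2 * CA * (M + δ₀) ≤ 128 * (M + 1) := by
      have := mul_le_mul hCA64 (add_le_add_left hδ₀1 M) (by positivity) (by norm_num)
      linarith
    have h2 : 2 * ε₀ * CA * M ≤ 128 * M := by
      have : ε₀ * CA ≤ 1 * 64 := mul_le_mul hε1 hCA64 hCA zero_le_one
      nlinarith
    nlinarith
  have hexp := Real.exp_le_exp.2 hk
  have hmax : max (δ₀ ^ 2) (q * M ^ 2) ≤ δ₀ ^ 2 * (1 + 1300 ^ 2 * q * M ^ 2) := by
    rcases le_total (δ₀ ^ 2) (q * M ^ 2) with hc | hc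
    · rw [max_eq_right hc]
      have : q * M ^ 2 ≤ 1300 ^ 2 * δ₀ ^ 2 * (q * M ^ 2) := by
        have := mul_le_mul_of_nonneg_right hδinv (by positivity : 0 ≤ q * M ^ 2); linarith
      nlinarith [sq_nonneg δ₀]
    · rw [max_eq_left hc]; nlinarith [sq_nonneg δ₀, mul_nonneg hq0 (sq_nonneg M)]
  -- `δ₀² ≤ RHS ≤ δ₀² · (2048 ε₀ A e^{k₆₄}(1+1300²qM²)) < δ₀²`
  have hE0 := (Real.exp_pos ((2 * CA * (M + δ₀) + 2 * ε₀ * CA * M) * (5 / 2))).le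
  have h1 : 32 * ε₀ * CA * A * Real.exp ((2 * CA * (M + δ₀) + 2 * ε₀ * CA * M) * (5 / 2)) * max (δ₀ ^ 2) (q * M ^ 2)
      ≤ 32 * ε₀ * 64 * A * Real.exp ((128 * (M + 1) + 128 * M) * (5 / 2)) * (δ₀ ^ 2 * (1 + 1300 ^ 2 * q * M ^ 2)) := by
    have ha : 32 * ε₀ * CA * A ≤ 32 * ε₀ * 64 * A := by
      have := mul_le_mul_of_nonneg_left hCA64 (by positivity : 0 ≤ 32 * ε₀)
      exact mul_le_mul_of_nonneg_right this hA0
    have hb := mul_le_mul ha hexp hE0 (by positivity)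
    exact mul_le_mul hb hmax (le_trans (sq_nonneg _) (le_max_left _ _)) (by positivity)
  have h2 : 32 * ε₀ * 64 * A * Real.exp ((128 * (M + 1) + 128 * M) * (5 / 2)) * (δ₀ ^ 2 * (1 + 1300 ^ 2 * q * M ^ 2))
      = δ₀ ^ 2 * (2048 * ε₀ * A * Real.exp ((128 * (M + 1) + 128 * M) * (5 / 2)) * (1 + 1300 ^ 2 * q * M ^ 2)) := by
    ring
  have h3 : δ₀ ^ 2 * (2048 * ε₀ * A * Real.exp ((128 * (M + 1) + 128 * M) * (5 / 2)) * (1 + 1300 ^ 2 * q * M ^ 2))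
      < δ₀ ^ 2 * 1 := mul_lt_mul_of_pos_left hsmall (by positivity)
  have := h.trans h1
  rw [h2] at this
  linarith

end Summit.NavierStokesRegularity.NavierStokesRegularity.Theorems.NoSurvivingDSSOne.LeakyFront

end
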